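import Literature.Geometry.Lorentzian.CoordScalarCurvatureAdjoint
import Literature.Geometry.Lorentzian.CoordMomentumConstraintVariation
import Literature.Geometry.Lorentzian.CoordPairingDerivQuadratic
import HarnessLib

/-!
# The linearised momentum constraint as an operator, its formal adjoint and the Green identity

Everything here is PROVED; the file introduces the explicit definitions `linKoszulCLM`,
`linChrAt`, `linMomFn`, `adjMomK`, `adjMomG`, `momGreenVec` and no statement of `Prop` type.

In the coordinate tensor calculus (`MetricCoord.IsMetricOn G V`, any signature), for smooth
symmetric `2`-tensor fields `K` (second fundamental form), `γ` (metric variation), `κ`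
(variation of `K`) and a smooth vector field `X` on `V`:

* `linChrAt G γ x` — the **linearised Christoffel map** `Π_γ(X,Y) = ½ ♯[(∇_Xγ)(Y,·) + (∇_Yγ)(X,·)
  − (∇γ)(·;X,Y)]` of a field (Besse 1987, Thm. 1.174 (a)); `IsMetricFamilyOn.varChrAt_eq_linChrAt`:
  along a smooth family of metrics `∂_t Γ = Π_{∂_t G}`; `IsMetricOn.sum_ginv_smul_linChrAt`: its
  metric trace is `W_γ = (div_G γ)^♯ − ½ ∇ tr_G γ` (`linScalVec`);
* `linMomFn b G K γ κ x Z` — the **linearised momentum constraint** `DM_{(G,K)}(γ, κ)(Z)`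
  (`M = div_G K − d tr_G K`, `momFn`), with `IsMetricFamilyOn.hasDerivWithinAt_momFn_linMomFn`:
  along a smooth family of data `∂_t M = DM_{(G_t,K_t)}(∂_t G, ∂_t K)`;
* `IsMetricOn.divAt_sharpAt_contractVec` — `div((κ(Y,·))^♯) = Σ g^{kl}(∇_{b_k}κ)(b_l, Y) + ⟨κ, G(∇Y·,·)⟩`;
* `IsMetricOn.momGreen_kappa` — `(div_G κ)(X) − ∂_X tr_G κ = div((κ(X,·))^♯ − (tr_G κ)X) − ⟨κ, G(∇X·,·)⟩ + tr_G κ · div X`;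
* `sum_neg_sharp_mul_eq_neg_pairAt` (`Σ ∂g^{kl} C_{kl} = −⟨γ, C⟩`), `sum_ginv_apply_linChrAt`
  (`Σ g^{kl} K(b_l, Π_γ(b_k, X)) = ½⟨∇_Xγ, K⟩`);
* `adjMomK G X x = −G(∇X·,·) + (div X) G`, `adjMomG G K X x = −(∇K)(·;·,X) + G(∇Y·,·) − ½(div Y)G
  − ½(div X)K + ½∇_X K` (`Y = (K(X,·))^♯`) — the two components of the **formal adjoint `DM*`**,
  and `IsMetricOn.linMomFn_apply_eq` — the **Green identity**
  `DM_{(G,K)}(γ,κ)(X) = ⟨γ, DM*_γ X⟩_G + ⟨κ, DM*_κ X⟩_G + div_G C` with the explicit `C = momGreenVec`.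
  With `J = −2M`, `Y = −½ X^♭`, `N = 0` these are the rows of Chruściel–Delay's `P*(Y, N)`
  (2003, §2), i.e. the (vector part of the) KID operator; the `N`-rows are
  `CoordScalarCurvatureAdjoint.adjScalAt` and the algebraic `K`-terms of `hasDerivWithinAt_hamAt`.

## References

* P. T. Chruściel, E. Delay, *On mapping properties of the general relativistic constraints
  operator in weighted function spaces*, Mém. SMF 94 (2003), §2 (the operators `P`, `P*`).
  [ChruscielDelay2003]
* A. L. Besse, *Einstein manifolds*, 1987, Thm. 1.174 (a). [Besse1987]
* R. Bartnik, J. Isenberg, *The constraint equations*, 2004, §2, (2.2). [BartnikIsenberg2004]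
* V. Moncrief, *Spacetime symmetries and linearization stability of the Einstein equations. I*,
  J. Math. Phys. 16 (1975), 493–498.
-/

noncomputable section

set_option maxSynthPendingDepth 3

open Set Filter ContinuousLinearMap Module
open scoped Topology ContDiff

namespace Literature.Geometry.Lorentzian

namespace MetricCoord

variable {E : Type*} [NormedAddCommGroup E] [NormedSpace ℝ E]

section Helpers

variable [FiniteDimensional ℝ E] {G : E → E →L[ℝ] E →L[ℝ] ℝ} {x : E}

/-- `div (W − U) = div W − div U` (a private copy of the lemma of
`Riemannian/VectorFieldBochnerFormula.lean`, to keep the import cone small). [folklore] -/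
private theorem divAt_sub' {W U : E → E} (hW : DifferentiableAt ℝ W x) (hU : DifferentiableAt ℝ U x) :
    divAt G (fun y ↦ W y - U y) x = divAt G W x - divAt G U x := by
  rw [divAt_eq, covDAt_sub hW hU, map_sub, divAt_eq, divAt_eq]

end Helpers

/-! ### The linearised Christoffel map of a field -/

section LinChr

variable (G : E → E →L[ℝ] E →L[ℝ] ℝ) (γ : E → E →L[ℝ] E →L[ℝ] ℝ)

/-- The **linearised Koszul form** of a `2`-tensor field `γ`:
`(X, Y, Z) ↦ (∇_X γ)(Y, Z) + (∇_Y γ)(X, Z) − (∇_Z γ)(X, Y)`. [cite: Besse1987, Thm. 1.174 (a)] -/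
def linKoszulCLM (x : E) : E →L[ℝ] E →L[ℝ] E →L[ℝ] ℝ :=
  cov₂At G γ x + (cov₂At G γ x).flip - flipCLM.comp (cov₂At G γ x).flip

/-- Unfolding lemma for `linKoszulCLM`. [cite: Besse1987, Thm. 1.174 (a)] -/
@[simp]
theorem linKoszulCLM_apply (x X Y Z : E) :
    linKoszulCLM G γ x X Y Z =
      cov₂At G γ x X Y Z + cov₂At G γ x Y X Z - cov₂At G γ x Z X Y := by
  simp [linKoszulCLM, flipCLM_apply]

/-- The **linearised Christoffel map** `Π_γ = D'_g γ` of a `2`-tensor field `γ` (Besse 1987,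
Thm. 1.174 (a): `g(D'_g h(X,Y), Z) = ½{D_X h(Y,Z) + D_Y h(X,Z) − D_Z h(X,Y)}`):
`Π_γ(X, Y) = ½ ♯[(∇_X γ)(Y,·) + (∇_Y γ)(X,·) − (∇_· γ)(X,Y)]`; along a family of metrics it is
the variation `∂_t Γ` of the Christoffel map (`IsMetricFamilyOn.varChrAt_eq_linChrAt`).
[cite: Besse1987, Thm. 1.174 (a)] -/
def linChrAt (x : E) : E →L[ℝ] E →L[ℝ] E :=
  (2⁻¹ : ℝ) • ((ContinuousLinearMap.compL ℝ E (E →L[ℝ] ℝ) E (sharpAt G x)).comp (linKoszulCLM G γ x))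

/-- Unfolding lemma: `Π_γ(X,Y) = ½ ♯ (linKoszul(X,Y,·))`. [cite: Besse1987, Thm. 1.174 (a)] -/
theorem linChrAt_apply (x X Y : E) :
    linChrAt G γ x X Y = (2⁻¹ : ℝ) • sharpAt G x (linKoszulCLM G γ x X Y) := by
  simp [linChrAt]

variable {G γ} {x : E}

/-- `G(Π_γ(X,Y), Z) = ½[(∇_X γ)(Y,Z) + (∇_Y γ)(X,Z) − (∇_Z γ)(X,Y)]`. [cite: Besse1987, Thm. 1.174 (a)] -/
theorem apply_linChrAt (hx : (G x).IsInvertible) (X Y Z : E) :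
    G x (linChrAt G γ x X Y) Z =
      2⁻¹ * (cov₂At G γ x X Y Z + cov₂At G γ x Y X Z - cov₂At G γ x Z X Y) := by
  rw [linChrAt_apply, map_smul, smul_apply, apply_sharpAt_apply hx, linKoszulCLM_apply, smul_eq_mul]

end LinChr

namespace IsMetricFamilyOn

variable {G : ℝ → E → E →L[ℝ] E →L[ℝ] ℝ} {S : Set ℝ} {V : Set E} {x : E} {t : ℝ} [CompleteSpace E]
  (hG : IsMetricFamilyOn G S V)
include hG

/-- **`∂_t Γ = Π_h` with `h = ∂_t G`** (Topping 2006, Prop. 2.3.1; Besse 1987, 1.174 (a)).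
[cite: Besse1987, Thm. 1.174 (a)] -/
theorem varChrAt_eq_linChrAt (hx : x ∈ V) (ht : t ∈ S) :
    varChrAt G S t x = linChrAt (G t) (tDeriv G S t) x := by
  have hi := (hG.isMetricOn t ht).isInvertible x hx
  ext X Y
  have hforms : G t x (varChrAt G S t x X Y) = G t x (linChrAt (G t) (tDeriv G S t) x X Y) := by
    ext Z
    rw [hG.apply_varChrAt hx ht, apply_linChrAt hi]
  have h := congrArg (sharpAt (G t) x) hforms
  rwa [sharpAt_apply hi, sharpAt_apply hi] at h

end IsMetricFamilyOn



/-! ### The linearised momentum constraint as an operator on fields -/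

section LinMom

variable {ι : Type*} [Fintype ι] [FiniteDimensional ℝ E] (b : Basis ι ℝ E)
  (G K γ κ : E → E →L[ℝ] E →L[ℝ] ℝ)

/-- The **linearised momentum constraint** `DM_{(G,K)}(γ, κ)(Z)` at `x`, in the basis `b`:
`Σ_{kl} (−♯γ♯)^{kl} (∇_{b_k}K)(b_l, Z) + Σ_{kl} g^{kl}[(∇_{b_k}κ)(b_l,Z) − K(Π_γ(b_k,b_l), Z)
 − K(b_l, Π_γ(b_k,Z))] − ∂_Z (tr_G κ − ⟨γ, K⟩_G)`; along a smooth family of data it is the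
`t`-derivative of `momFn` (`IsMetricFamilyOn.hasDerivWithinAt_momFn_linMomFn`).
(Chruściel–Delay 2003, §2: the first row of `P(Q,h)` is `−2` times this, with `h = γ`, `Q = κ`.)
[cite: ChruscielDelay2003, §2] -/
def linMomFn (x Z : E) : ℝ :=
  ∑ k, ∑ l, (b.coord k (-(sharpAt G x (γ x (sharpAt G x (coordCLM b l))))) * cov₂At G K x (b k) (b l) Z
    + ginv G b x k l * (cov₂At G κ x (b k) (b l) Z
      - K x (linChrAt G γ x (b k) (b l)) Z - K x (b l) (linChrAt G γ x (b k) Z)))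
  - fderiv ℝ (fun y ↦ mtrAt G y (κ y) - pairAt G y (γ y) (K y)) x Z

/-- Unfolding lemma for `linMomFn`. [cite: ChruscielDelay2003, §2] -/
theorem linMomFn_eq (x Z : E) :
    linMomFn b G K γ κ x Z =
      ∑ k, ∑ l, (b.coord k (-(sharpAt G x (γ x (sharpAt G x (coordCLM b l))))) * cov₂At G K x (b k) (b l) Z
        + ginv G b x k l * (cov₂At G κ x (b k) (b l) Z
          - K x (linChrAt G γ x (b k) (b l)) Z - K x (b l) (linChrAt G γ x (b k) Z)))
      - fderiv ℝ (fun y ↦ mtrAt G y (κ y) - pairAt G y (γ y) (K y)) x Z := rfl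

end LinMom

namespace IsMetricFamilyOn

variable {ι : Type*} [Fintype ι] [FiniteDimensional ℝ E] [CompleteSpace E]
  {G K : ℝ → E → E →L[ℝ] E →L[ℝ] ℝ} {S : Set ℝ} {V : Set E} {x : E} {t : ℝ} (b : Basis ι ℝ E)
  (hG : IsMetricFamilyOn G S V) (hK : ContDiffOn ℝ ∞ (fun p : E × ℝ ↦ K p.2 p.1) (V ×ˢ S))
include hG hK

/-- **`∂_t M = DM_{(G,K)}(∂_t G, ∂_t K)`** along a smooth family of data.
[cite: BartnikIsenberg2004, (2.2)] -/
theorem hasDerivWithinAt_momFn_linMomFn (hx : x ∈ V) (ht : t ∈ S) (Z : E) :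
    HasDerivWithinAt (fun s ↦ momFn b (G s) (K s) x Z)
      (linMomFn b (G t) (K t) (tDeriv G S t) (tDeriv K S t) x Z) S t := by
  have h := hG.hasDerivWithinAt_momFn b hK hx ht Z
  rw [hG.varChrAt_eq_linChrAt hx ht] at h
  exact h

end IsMetricFamilyOn

/-! ### The Green identity for the linearised momentum constraint: the `κ`-part -/

section MomAdjoint

variable {ι : Type*} [Fintype ι] [FiniteDimensional ℝ E] [CompleteSpace E] (b : Basis ι ℝ E)
  {G : E → E →L[ℝ] E →L[ℝ] ℝ} {V : Set E} {x : E}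

/-- **The divergence of a contraction** `(κ(Y, ·))^♯` of a smooth symmetric `2`-tensor `κ` with
a smooth vector field `Y`: `div((κ(Y,·))^♯) = Σ_{kl} g^{kl}(∇_{b_k}κ)(b_l, Y) + ⟨κ, G(∇Y ·, ·)⟩_G`
(Leibniz rule, `∇♯ = ♯∇`). [cite: ONeill1983, Ch. 3, p. 86] -/
theorem IsMetricOn.divAt_sharpAt_contractVec (hG : IsMetricOn G V) (hx : x ∈ V)
    {κ : E → E →L[ℝ] E →L[ℝ] ℝ} (hκ : ContDiffOn ℝ ∞ κ V) (hs : ∀ y ∈ V, ∀ v w, κ y v w = κ y w v)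
    {Y : E → E} (hY : DifferentiableAt ℝ Y x) :
    divAt G (fun y ↦ sharpAt G y (κ y (Y y))) x =
      ∑ k, ∑ l, ginv G b x k l * cov₂At G κ x (b k) (b l) (Y x)
        + pairAt G x (κ x) ((G x).comp (covDAt G Y x)) := by
  have hi := hG.isInvertible x hx
  have hκd : DifferentiableAt ℝ κ x := ((hκ x hx).contDiffAt (hG.mem_nhds hx)).differentiableAt (by simp)
  -- the covector field `θ = κ(Y, ·)` and its derivative
  have hθ : HasFDerivAt (fun y ↦ κ y (Y y))
      ((κ x).comp (fderiv ℝ Y x) + (fderiv ℝ κ x).flip (Y x)) x :=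
    hκd.hasFDerivAt.clm_apply hY.hasFDerivAt
  have hθD : ∀ X w, fderiv ℝ (fun y ↦ κ y (Y y)) x X w =
      κ x (fderiv ℝ Y x X) w + fderiv ℝ κ x X (Y x) w := by
    intro X w
    rw [hθ.fderiv, _root_.add_apply, ContinuousLinearMap.comp_apply, flip_apply, _root_.add_apply]
  rw [hG.divAt_sharpAt b hx hθ.differentiableAt, pairAt_eq_sum_ginv b]
  simp only [hθD, cov₂At_apply, ContinuousLinearMap.comp_apply,
    sharpAt_apply hi, covDAt_apply, map_add, _root_.add_apply]
  have hsx := hs x hx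
  have hcs : ∀ k l, fderiv ℝ κ x (b k) (b l) (Y x) - κ x (chrAt G x (b k) (b l)) (Y x)
      - κ x (b l) (chrAt G x (b k) (Y x)) =
      fderiv ℝ κ x (b k) (Y x) (b l) - κ x (chrAt G x (b k) (Y x)) (b l)
      - κ x (Y x) (chrAt G x (b k) (b l)) := by
    intro k l
    have hsev : ∀ᶠ y in 𝓝 x, ∀ v w, κ y v w = κ y w v :=
      (hG.eventually_mem hx).mono fun y hy ↦ hs y hy
    have h1 := cov₂At_symm (G := G) hκd hsev (b k) (b l) (Y x)
    simp only [cov₂At_apply] at h1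
    exact h1
  simp only [hcs]
  rw [← Finset.sum_add_distrib]
  refine Finset.sum_congr rfl fun k _ ↦ ?_
  rw [← Finset.sum_add_distrib]
  refine Finset.sum_congr rfl fun l _ ↦ ?_
  rw [hsx (Y x) (chrAt G x (b k) (b l)), hG.chrAt_comm hx (Y x) (b k)]
  ring

/-- **The Green identity for the `κ`-part of `DM`**: for a smooth symmetric `κ` and a smooth
vector field `X`,
`(div_G κ)(X) − ∂_X tr_G κ = div((κ(X,·))^♯ − (tr_G κ) X) − ⟨κ, G(∇X·,·)⟩_G + (tr_G κ)(div X)`,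
i.e. `⟨X, DM_κ(κ)⟩ = ⟨κ, −G(∇X·,·) + (div X) G⟩_G + div(…)` (Chruściel–Delay 2003, §2, the
`Q`-column of `P*`: `2(∇_{(i}Y_{j)} − ∇^l Y_l g_{ij})` for `J = −2M`). [cite: ChruscielDelay2003, §2] -/
theorem IsMetricOn.momGreen_kappa (hG : IsMetricOn G V) (hx : x ∈ V)
    {κ : E → E →L[ℝ] E →L[ℝ] ℝ} (hκ : ContDiffOn ℝ ∞ κ V) (hs : ∀ y ∈ V, ∀ v w, κ y v w = κ y w v)
    {X : E → E} (hX : ContDiffOn ℝ ∞ X V) :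
    ∑ k, ∑ l, ginv G b x k l * cov₂At G κ x (b k) (b l) (X x) - fderiv ℝ (fun y ↦ mtrAt G y (κ y)) x (X x) =
      divAt G (fun y ↦ sharpAt G y (κ y (X y)) - mtrAt G y (κ y) • X y) x
        - pairAt G x (κ x) ((G x).comp (covDAt G X x)) + mtrAt G x (κ x) * divAt G X x := by
  have hXd : DifferentiableAt ℝ X x := ((hX x hx).contDiffAt (hG.mem_nhds hx)).differentiableAt (by simp)
  have hκd : DifferentiableAt ℝ κ x := ((hκ x hx).contDiffAt (hG.mem_nhds hx)).differentiableAt (by simp)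
  have hτ : ContDiffOn ℝ ∞ (fun y ↦ mtrAt G y (κ y)) V := hG.contDiffOn_mtrAt hκ
  have hτd : DifferentiableAt ℝ (fun y ↦ mtrAt G y (κ y)) x :=
    ((hτ x hx).contDiffAt (hG.mem_nhds hx)).differentiableAt (by simp)
  have h1 : DifferentiableAt ℝ (fun y ↦ sharpAt G y (κ y (X y))) x :=
    (hG.differentiableAt_sharpAt hx).clm_apply (hκd.clm_apply hXd)
  have h2 : DifferentiableAt ℝ (fun y ↦ mtrAt G y (κ y) • X y) x := hτd.smul hXd
  rw [divAt_sub' h1 h2, hG.divAt_sharpAt_contractVec b hx hκ hs hXd, divAt_smul hτd hXd]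
  ring

end MomAdjoint

/-! ### The Green identity for the linearised momentum constraint: the `γ`-part -/

section MomAdjointGamma

variable {ι : Type*} [Fintype ι] [FiniteDimensional ℝ E] [CompleteSpace E] (b : Basis ι ℝ E)
  {G : E → E →L[ℝ] E →L[ℝ] ℝ} {V : Set E} {x : E}

omit [CompleteSpace E] in
/-- **`Σ_{kl} ∂g^{kl} C_{kl} = −⟨γ, C⟩_G`** for `∂g^{kl} = −(♯γ♯)^{kl}` and any bilinear form `C`
(Topping 2006, Prop. 2.3.6). [cite: Topping2006, Prop. 2.3.6] -/
theorem sum_neg_sharp_mul_eq_neg_pairAt (η C : E →L[ℝ] E →L[ℝ] ℝ) :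
    ∑ k, ∑ l, b.coord k (-(sharpAt G x (η (sharpAt G x (coordCLM b l))))) * C (b k) (b l) =
      -pairAt G x η C := by
  rw [pairAt_apply, traceCLM_apply, trace_eq_sum_coord b, ← Finset.sum_neg_distrib]
  refine Finset.sum_congr rfl fun k _ ↦ ?_
  have hCk : C (b k) = ∑ l, C (b k) (b l) • coordCLM b l := eq_sum_smul_coordCLM b _
  simp only [map_neg, neg_mul, Finset.sum_neg_distrib, ContinuousLinearMap.coe_coe,
    ContinuousLinearMap.comp_apply]
  conv_rhs => rw [hCk]
  simp only [map_sum, map_smul, smul_eq_mul]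
  congr 1
  refine Finset.sum_congr rfl fun l _ ↦ ?_
  ring

/-- **The metric trace of `Π_γ` is `W_γ = (div_G γ)^♯ − ½ ∇ tr_G γ`** (Besse 1987, 1.174 (a)
traced). [cite: Besse1987, Thm. 1.174 (a)] -/
theorem IsMetricOn.sum_ginv_smul_linChrAt (hG : IsMetricOn G V) (hx : x ∈ V)
    {γ : E → E →L[ℝ] E →L[ℝ] ℝ} (hγ : DifferentiableAt ℝ γ x) :
    ∑ k, ∑ l, ginv G b x k l • linChrAt G γ x (b k) (b l) = linScalVec b G γ x := by
  have hi := hG.isInvertible x hx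
  have hforms : G x (∑ k, ∑ l, ginv G b x k l • linChrAt G γ x (b k) (b l)) = G x (linScalVec b G γ x) := by
    ext Z
    simp only [map_sum, map_smul, FunLike.coe_sum, Finset.sum_apply, FunLike.coe_smul, Pi.smul_apply,
      smul_eq_mul, apply_linChrAt hi]
    rw [linScalVec, map_sub, map_smul, _root_.sub_apply, _root_.smul_apply, apply_divFormVec b hi,
      apply_sharpAt_apply hi, smul_eq_mul, hG.fderiv_mtrAt hx hγ Z, mtrAt_eq_sum b]
    have h2 : ∑ k, ∑ l, ginv G b x k l * cov₂At G γ x (b l) (b k) Z =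
        ∑ k, ∑ l, ginv G b x k l * cov₂At G γ x (b k) (b l) Z := by
      rw [Finset.sum_comm]
      refine Finset.sum_congr rfl fun k _ ↦ Finset.sum_congr rfl fun l _ ↦ ?_
      rw [ginv_comm b hi (hG.symm x hx) l k]
    have key : ∀ (P Q R g : ι → ι → ℝ), ∑ k, ∑ l, g k l * (2⁻¹ * (P k l + Q k l - R k l)) =
        2⁻¹ * ((∑ k, ∑ l, g k l * P k l) + (∑ k, ∑ l, g k l * Q k l) - ∑ k, ∑ l, g k l * R k l) := by
      intro P Q R g
      simp only [Finset.mul_sum, ← Finset.sum_add_distrib, ← Finset.sum_sub_distrib]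
      refine Finset.sum_congr rfl fun k _ ↦ Finset.sum_congr rfl fun l _ ↦ ?_
      ring
    rw [key (fun k l ↦ cov₂At G γ x (b k) (b l) Z) (fun k l ↦ cov₂At G γ x (b l) (b k) Z)
      (fun k l ↦ cov₂At G γ x Z (b k) (b l)) (fun k l ↦ ginv G b x k l), h2]
    simp only [cov₂At_apply]
    ring
  have h := congrArg (sharpAt G x) hforms
  rwa [sharpAt_apply hi, sharpAt_apply hi] at h

omit [CompleteSpace E] in
/-- **`Σ_{kl} g^{kl} K(b_l, Π_γ(b_k, X)) = ½ ⟨∇_X γ, K⟩_G`** for symmetric `K` and `∇γ` symmetric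
in its last two slots (the two other contractions of `Π_γ` against `K` cancel).
[cite: ChruscielDelay2003, §2] -/
theorem sum_ginv_apply_linChrAt (hi : (G x).IsInvertible) (hGs : ∀ v w, G x v w = G x w v)
    {γ : E → E →L[ℝ] E →L[ℝ] ℝ} (hcs : ∀ W Y Z, cov₂At G γ x W Y Z = cov₂At G γ x W Z Y)
    {Kx : E →L[ℝ] E →L[ℝ] ℝ} (hKs : ∀ v w, Kx v w = Kx w v) (X : E) :
    ∑ k, ∑ l, ginv G b x k l * Kx (b l) (linChrAt G γ x (b k) X) =
      2⁻¹ * pairAt G x (cov₂At G γ x X) Kx := by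
  have hgs : ∀ k l, ginv G b x k l = ginv G b x l k := fun k l ↦ ginv_comm b hi hGs k l
  -- `K(b_l, v) = G(v, Y_l)` with `Y_l = ♯ K(b_l, ·)`
  have hKY : ∀ l v, Kx (b l) v = G x v (sharpAt G x (Kx (b l))) := fun l v ↦ by
    rw [hGs, apply_sharpAt_apply hi]
  simp only [hKY, apply_linChrAt hi]
  -- the three contractions
  have hY : ∀ l, sharpAt G x (Kx (b l)) = ∑ m, (∑ n, ginv G b x m n * Kx (b l) (b n)) • b m :=
    fun l ↦ sharpAt_eq_sum b _
  have hA : ∑ k, ∑ l, ginv G b x k l * cov₂At G γ x (b k) X (sharpAt G x (Kx (b l))) =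
      ∑ k, ∑ l, ∑ m, ∑ n, ginv G b x k l * ginv G b x m n * Kx (b l) (b n) * cov₂At G γ x (b k) X (b m) := by
    refine Finset.sum_congr rfl fun k _ ↦ Finset.sum_congr rfl fun l _ ↦ ?_
    rw [hY l]
    simp only [map_sum, map_smul, smul_eq_mul, Finset.mul_sum]
    refine Finset.sum_congr rfl fun m _ ↦ ?_
    rw [Finset.sum_mul, Finset.mul_sum]
    refine Finset.sum_congr rfl fun n _ ↦ ?_
    ring
  have hC : ∑ k, ∑ l, ginv G b x k l * cov₂At G γ x (sharpAt G x (Kx (b l))) (b k) X =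
      ∑ k, ∑ l, ∑ m, ∑ n, ginv G b x k l * ginv G b x m n * Kx (b l) (b n) * cov₂At G γ x (b m) X (b k) := by
    refine Finset.sum_congr rfl fun k _ ↦ Finset.sum_congr rfl fun l _ ↦ ?_
    rw [hY l]
    simp only [map_sum, map_smul, FunLike.coe_sum, Finset.sum_apply, FunLike.coe_smul, Pi.smul_apply,
      smul_eq_mul, Finset.mul_sum]
    refine Finset.sum_congr rfl fun m _ ↦ ?_
    rw [Finset.sum_mul, Finset.mul_sum]
    refine Finset.sum_congr rfl fun n _ ↦ ?_
    rw [hcs (b m) (b k) X]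
    ring
  have hAC : ∑ k, ∑ l, ∑ m, ∑ n, ginv G b x k l * ginv G b x m n * Kx (b l) (b n) * cov₂At G γ x (b m) X (b k) =
      ∑ k, ∑ l, ∑ m, ∑ n, ginv G b x k l * ginv G b x m n * Kx (b l) (b n) * cov₂At G γ x (b k) X (b m) := by
    -- swap the index pairs `(k,l) ↔ (m,n)`
    calc ∑ k, ∑ l, ∑ m, ∑ n, ginv G b x k l * ginv G b x m n * Kx (b l) (b n) * cov₂At G γ x (b m) X (b k)
        = ∑ k, ∑ m, ∑ l, ∑ n, ginv G b x k l * ginv G b x m n * Kx (b l) (b n) * cov₂At G γ x (b m) X (b k) :=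
          Finset.sum_congr rfl fun k _ ↦ Finset.sum_comm
      _ = ∑ m, ∑ k, ∑ l, ∑ n, ginv G b x k l * ginv G b x m n * Kx (b l) (b n) * cov₂At G γ x (b m) X (b k) :=
          Finset.sum_comm
      _ = ∑ m, ∑ k, ∑ n, ∑ l, ginv G b x k l * ginv G b x m n * Kx (b l) (b n) * cov₂At G γ x (b m) X (b k) :=
          Finset.sum_congr rfl fun m _ ↦ Finset.sum_congr rfl fun k _ ↦ Finset.sum_comm
      _ = ∑ m, ∑ n, ∑ k, ∑ l, ginv G b x k l * ginv G b x m n * Kx (b l) (b n) * cov₂At G γ x (b m) X (b k) :=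
          Finset.sum_congr rfl fun m _ ↦ Finset.sum_comm
      _ = ∑ k, ∑ l, ∑ m, ∑ n, ginv G b x k l * ginv G b x m n * Kx (b l) (b n) * cov₂At G γ x (b k) X (b m) := by
          refine Finset.sum_congr rfl fun m _ ↦ Finset.sum_congr rfl fun n _ ↦
            Finset.sum_congr rfl fun k _ ↦ Finset.sum_congr rfl fun l _ ↦ ?_
          rw [hKs (b l) (b n)]
          ring
  have hB : ∑ k, ∑ l, ginv G b x k l * cov₂At G γ x X (b k) (sharpAt G x (Kx (b l))) =
      pairAt G x (cov₂At G γ x X) Kx := by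
    rw [pairAt_eq_sum_ginv b, Finset.sum_comm]
    refine Finset.sum_congr rfl fun l _ ↦ Finset.sum_congr rfl fun k _ ↦ ?_
    rw [hgs k l, hcs X (b k)]
  have key : ∀ (P Q R g : ι → ι → ℝ), ∑ k, ∑ l, g k l * (2⁻¹ * (P k l + Q k l - R k l)) =
      2⁻¹ * ((∑ k, ∑ l, g k l * P k l) + (∑ k, ∑ l, g k l * Q k l) - ∑ k, ∑ l, g k l * R k l) := by
    intro P Q R g
    simp only [Finset.mul_sum, ← Finset.sum_add_distrib, ← Finset.sum_sub_distrib]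
    refine Finset.sum_congr rfl fun k _ ↦ Finset.sum_congr rfl fun l _ ↦ ?_
    ring
  rw [key (fun k l ↦ cov₂At G γ x (b k) X (sharpAt G x (Kx (b l))))
    (fun k l ↦ cov₂At G γ x X (b k) (sharpAt G x (Kx (b l))))
    (fun k l ↦ cov₂At G γ x (sharpAt G x (Kx (b l))) (b k) X) (fun k l ↦ ginv G b x k l), hA, hC, hAC, hB]
  ring

variable (G) in
/-- The **`κ`-component of the formal adjoint of `DM`**: `DM*_κ(X) = −G(∇X ·, ·) + (div X) G`
(pairing a symmetric `κ` sees `−½ 𝓛_X G + (div X) G`; Chruściel–Delay 2003, §2, the `Q`-row of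
`P*(Y,N)` with `Y = −½ X^♭`). [cite: ChruscielDelay2003, §2] -/
def adjMomK (X : E → E) (x : E) : E →L[ℝ] E →L[ℝ] ℝ :=
  -(G x).comp (covDAt G X x) + (divAt G X x) • G x

variable (G) in
/-- The **`γ`-component of the formal adjoint of `DM`** at data `(G, K)`, for a vector field
`X`, with `Y = (K(X,·))^♯`:
`DM*_γ(X) = −(∇_{·}K)(·, X) + G(∇Y ·, ·) − ½ (div Y) G − ½ (div X) K + ½ ∇_X K`
(Chruściel–Delay 2003, §2, the `h`-row of `P*(Y,N)` with `N = 0`, `Y = −½ X^♭`).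
[cite: ChruscielDelay2003, §2] -/
def adjMomG (K : E → E →L[ℝ] E →L[ℝ] ℝ) (X : E → E) (x : E) : E →L[ℝ] E →L[ℝ] ℝ :=
  -(flipCLM.comp (cov₂At G K x)).flip (X x)
    + (G x).comp (covDAt G (fun y ↦ sharpAt G y (K y (X y))) x)
    - (2⁻¹ * divAt G (fun y ↦ sharpAt G y (K y (X y))) x) • G x
    - (2⁻¹ * divAt G X x) • K x + (2⁻¹ : ℝ) • cov₂At G K x (X x)

variable (G) in
/-- The **boundary vector field of the Green identity for `DM`**. [cite: ChruscielDelay2003, §2] -/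
def momGreenVec (K γ κ : E → E →L[ℝ] E →L[ℝ] ℝ) (X : E → E) (y : E) : E :=
  sharpAt G y (κ y (X y)) - mtrAt G y (κ y) • X y
    - sharpAt G y (γ y (sharpAt G y (K y (X y))))
    + (2⁻¹ * mtrAt G y (γ y)) • sharpAt G y (K y (X y))
    + (2⁻¹ * pairAt G y (γ y) (K y)) • X y

/-- **The Green identity for the linearised momentum constraint** (Chruściel–Delay 2003, §2:
the formal `L²`-adjoint `P*` of the linearised constraint operator; Fischer–Marsden–Moncrief):
for smooth symmetric `K, γ, κ` and a smooth vector field `X` on `V`, pointwise on `V`,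

  `DM_{(G,K)}(γ, κ)(X) = ⟨γ, DM*_γ(X)⟩_G + ⟨κ, DM*_κ(X)⟩_G + div_G C`

with `DM*_κ`, `DM*_γ`, `C` the explicit `adjMomK`, `adjMomG`, `momGreenVec`.
[cite: ChruscielDelay2003, §2] -/
theorem IsMetricOn.linMomFn_apply_eq (hG : IsMetricOn G V) (hx : x ∈ V)
    {K γ κ : E → E →L[ℝ] E →L[ℝ] ℝ} (hK : ContDiffOn ℝ ∞ K V) (hKs : ∀ y ∈ V, ∀ v w, K y v w = K y w v)
    (hγ : ContDiffOn ℝ ∞ γ V) (hγs : ∀ y ∈ V, ∀ v w, γ y v w = γ y w v)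
    (hκ : ContDiffOn ℝ ∞ κ V) (hκs : ∀ y ∈ V, ∀ v w, κ y v w = κ y w v)
    {X : E → E} (hX : ContDiffOn ℝ ∞ X V) :
    linMomFn b G K γ κ x (X x) =
      pairAt G x (γ x) (adjMomG G K X x) + pairAt G x (κ x) (adjMomK G X x)
        + divAt G (momGreenVec G K γ κ X) x := by
  have hi := hG.isInvertible x hx
  have hGs := hG.symm x hx
  -- differentiability of the ingredients
  have hXd : DifferentiableAt ℝ X x := ((hX x hx).contDiffAt (hG.mem_nhds hx)).differentiableAt (by simp)
  have hKd : DifferentiableAt ℝ K x := ((hK x hx).contDiffAt (hG.mem_nhds hx)).differentiableAt (by simp)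
  have hγd : DifferentiableAt ℝ γ x := ((hγ x hx).contDiffAt (hG.mem_nhds hx)).differentiableAt (by simp)
  have hκd : DifferentiableAt ℝ κ x := ((hκ x hx).contDiffAt (hG.mem_nhds hx)).differentiableAt (by simp)
  have hsh := hG.differentiableAt_sharpAt hx
  have hτκ : ContDiffOn ℝ ∞ (fun y ↦ mtrAt G y (κ y)) V := hG.contDiffOn_mtrAt hκ
  have hτγ : ContDiffOn ℝ ∞ (fun y ↦ mtrAt G y (γ y)) V := hG.contDiffOn_mtrAt hγ
  have hτκd : DifferentiableAt ℝ (fun y ↦ mtrAt G y (κ y)) x :=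
    ((hτκ x hx).contDiffAt (hG.mem_nhds hx)).differentiableAt (by simp)
  have hτγd : DifferentiableAt ℝ (fun y ↦ mtrAt G y (γ y)) x :=
    ((hτγ x hx).contDiffAt (hG.mem_nhds hx)).differentiableAt (by simp)
  set Yv : E → E := fun y ↦ sharpAt G y (K y (X y)) with hYv
  have hYc : ContDiffOn ℝ ∞ Yv V := hG.contDiffOn_sharpAt.clm_apply (hK.clm_apply hX)
  have hYd : DifferentiableAt ℝ Yv x := ((hYc x hx).contDiffAt (hG.mem_nhds hx)).differentiableAt (by simp)
  have hPd : DifferentiableAt ℝ (fun y ↦ pairAt G y (γ y) (K y)) x := by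
    have h1 : DifferentiableAt ℝ (fun y ↦ ((sharpAt G y).comp (γ y)).comp ((sharpAt G y).comp (K y))) x :=
      (hsh.clm_comp hγd).clm_comp (hsh.clm_comp hKd)
    have heq : (fun y ↦ pairAt G y (γ y) (K y)) =
        fun y ↦ traceCLM E (((sharpAt G y).comp (γ y)).comp ((sharpAt G y).comp (K y))) := by
      funext y; rw [pairAt_apply]
    rw [heq]
    exact (traceCLM E).differentiableAt.comp x h1
  -- (T1) the `∂g^{kl}` term
  have T1 : ∑ k, ∑ l, b.coord k (-(sharpAt G x (γ x (sharpAt G x (coordCLM b l)))))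
      * cov₂At G K x (b k) (b l) (X x) =
      -pairAt G x (γ x) ((flipCLM.comp (cov₂At G K x)).flip (X x)) := by
    rw [← sum_neg_sharp_mul_eq_neg_pairAt b]
    rfl
  -- (T2) the trace of `Π_γ` against `K`
  have T2 : ∑ k, ∑ l, ginv G b x k l * K x (linChrAt G γ x (b k) (b l)) (X x) =
      divAt G (fun y ↦ sharpAt G y (γ y (Yv y))) x
        - pairAt G x (γ x) ((G x).comp (covDAt G Yv x))
        - 2⁻¹ * (divAt G (fun y ↦ mtrAt G y (γ y) • Yv y) x - mtrAt G x (γ x) * divAt G Yv x) := by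
    have hsum : ∑ k, ∑ l, ginv G b x k l * K x (linChrAt G γ x (b k) (b l)) (X x) =
        K x (∑ k, ∑ l, ginv G b x k l • linChrAt G γ x (b k) (b l)) (X x) := by
      simp only [map_sum, map_smul, FunLike.coe_sum, Finset.sum_apply, FunLike.coe_smul, Pi.smul_apply,
        smul_eq_mul]
    rw [hsum, hG.sum_ginv_smul_linChrAt b hx hγd, hKs x hx, ← apply_sharpAt_apply hi (K x (X x)), hGs,
      linScalVec, map_sub, map_smul, _root_.sub_apply, _root_.smul_apply, smul_eq_mul,
      apply_sharpAt_apply hi, hG.divAt_sharpAt_contractVec b hx hγ hγs hYd, apply_divFormVec b hi,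
      divAt_smul hτγd hYd]
    ring
  -- (T3) the second contraction of `Π_γ` against `K`
  have hcs : ∀ W Y Z, cov₂At G γ x W Y Z = cov₂At G γ x W Z Y := by
    have hsev : ∀ᶠ y in 𝓝 x, ∀ v w, γ y v w = γ y w v := (hG.eventually_mem hx).mono fun y hy ↦ hγs y hy
    exact cov₂At_symm hγd hsev
  have T3 : ∑ k, ∑ l, ginv G b x k l * K x (b l) (linChrAt G γ x (b k) (X x)) =
      2⁻¹ * (fderiv ℝ (fun y ↦ pairAt G y (γ y) (K y)) x (X x) - pairAt G x (γ x) (cov₂At G K x (X x))) := by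
    rw [sum_ginv_apply_linChrAt b hi hGs hcs (hKs x hx) (X x), hG.fderiv_pairAt hx hγd hKd (X x)]
    ring
  -- (T4) and the `κ`-part
  have T4 : fderiv ℝ (fun y ↦ mtrAt G y (κ y) - pairAt G y (γ y) (K y)) x (X x) =
      fderiv ℝ (fun y ↦ mtrAt G y (κ y)) x (X x) - fderiv ℝ (fun y ↦ pairAt G y (γ y) (K y)) x (X x) := by
    rw [fderiv_fun_sub hτκd hPd, _root_.sub_apply]
  have Tκ := hG.momGreen_kappa b hx hκ hκs hX
  have T5 : fderiv ℝ (fun y ↦ pairAt G y (γ y) (K y)) x (X x) =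
      divAt G (fun y ↦ pairAt G y (γ y) (K y) • X y) x - pairAt G x (γ x) (K x) * divAt G X x := by
    rw [divAt_smul hPd hXd]
    ring
  -- the divergence of the boundary field
  have d1 : DifferentiableAt ℝ (fun y ↦ sharpAt G y (κ y (X y))) x := hsh.clm_apply (hκd.clm_apply hXd)
  have d2 : DifferentiableAt ℝ (fun y ↦ mtrAt G y (κ y) • X y) x := hτκd.smul hXd
  have d3 : DifferentiableAt ℝ (fun y ↦ sharpAt G y (γ y (Yv y))) x := hsh.clm_apply (hγd.clm_apply hYd)
  have d4 : DifferentiableAt ℝ (fun y ↦ (2⁻¹ * mtrAt G y (γ y)) • Yv y) x := (hτγd.const_mul _).smul hYd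
  have d5 : DifferentiableAt ℝ (fun y ↦ (2⁻¹ * pairAt G y (γ y) (K y)) • X y) x := (hPd.const_mul _).smul hXd
  have d12 : DifferentiableAt ℝ (fun y ↦ sharpAt G y (κ y (X y)) - mtrAt G y (κ y) • X y) x := d1.sub d2
  have d123 : DifferentiableAt ℝ (fun y ↦ sharpAt G y (κ y (X y)) - mtrAt G y (κ y) • X y
      - sharpAt G y (γ y (Yv y))) x := d12.sub d3
  have d1234 : DifferentiableAt ℝ (fun y ↦ sharpAt G y (κ y (X y)) - mtrAt G y (κ y) • X y
      - sharpAt G y (γ y (Yv y)) + (2⁻¹ * mtrAt G y (γ y)) • Yv y) x := d123.add d4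
  have dC : divAt G (momGreenVec G K γ κ X) x =
      divAt G (fun y ↦ sharpAt G y (κ y (X y)) - mtrAt G y (κ y) • X y) x
        - divAt G (fun y ↦ sharpAt G y (γ y (Yv y))) x
        + 2⁻¹ * divAt G (fun y ↦ mtrAt G y (γ y) • Yv y) x
        + 2⁻¹ * divAt G (fun y ↦ pairAt G y (γ y) (K y) • X y) x := by
    have h4 : DifferentiableAt ℝ (fun y ↦ mtrAt G y (γ y) • Yv y) x := hτγd.smul hYd
    have h5 : DifferentiableAt ℝ (fun y ↦ pairAt G y (γ y) (K y) • X y) x := hPd.smul hXd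
    have e4 : divAt G (fun y ↦ (2⁻¹ * mtrAt G y (γ y)) • Yv y) x =
        2⁻¹ * divAt G (fun y ↦ mtrAt G y (γ y) • Yv y) x := by
      rw [show (fun y ↦ (2⁻¹ * mtrAt G y (γ y)) • Yv y) = fun y ↦ (2⁻¹ : ℝ) • (mtrAt G y (γ y) • Yv y) from
        funext fun y ↦ by rw [smul_smul], divAt_const_smul h4]
    have e5 : divAt G (fun y ↦ (2⁻¹ * pairAt G y (γ y) (K y)) • X y) x =
        2⁻¹ * divAt G (fun y ↦ pairAt G y (γ y) (K y) • X y) x := by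
      rw [show (fun y ↦ (2⁻¹ * pairAt G y (γ y) (K y)) • X y) = fun y ↦ (2⁻¹ : ℝ) • (pairAt G y (γ y) (K y) • X y) from
        funext fun y ↦ by rw [smul_smul], divAt_const_smul h5]
    rw [show momGreenVec G K γ κ X = fun y ↦ (sharpAt G y (κ y (X y)) - mtrAt G y (κ y) • X y
        - sharpAt G y (γ y (Yv y)) + (2⁻¹ * mtrAt G y (γ y)) • Yv y)
        + (2⁻¹ * pairAt G y (γ y) (K y)) • X y from rfl,
      divAt_add d1234 d5, divAt_add d123 d4, divAt_sub' d12 d3, e4, e5]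
  -- pairings with the adjoint pieces
  have pG : pairAt G x (γ x) (adjMomG G K X x) =
      -pairAt G x (γ x) ((flipCLM.comp (cov₂At G K x)).flip (X x))
        + pairAt G x (γ x) ((G x).comp (covDAt G Yv x))
        - 2⁻¹ * divAt G Yv x * mtrAt G x (γ x)
        - 2⁻¹ * divAt G X x * pairAt G x (γ x) (K x)
        + 2⁻¹ * pairAt G x (γ x) (cov₂At G K x (X x)) := by
    rw [adjMomG]
    simp only [pairAt_add_right, pairAt_sub_right, pairAt_neg_right, pairAt_smul_right,
      pairAt_metric_right hi]
    ring
  have pK : pairAt G x (κ x) (adjMomK G X x) =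
      -pairAt G x (κ x) ((G x).comp (covDAt G X x)) + divAt G X x * mtrAt G x (κ x) := by
    rw [adjMomK, pairAt_add_right, pairAt_neg_right, pairAt_smul_right, pairAt_metric_right hi]
  -- assemble
  rw [linMomFn_eq, Finset.sum_congr rfl fun k _ ↦ Finset.sum_add_distrib, Finset.sum_add_distrib, T1, T4]
  have hsplit : ∑ k, ∑ l, ginv G b x k l * (cov₂At G κ x (b k) (b l) (X x)
      - K x (linChrAt G γ x (b k) (b l)) (X x) - K x (b l) (linChrAt G γ x (b k) (X x))) =
      (∑ k, ∑ l, ginv G b x k l * cov₂At G κ x (b k) (b l) (X x))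
      - (∑ k, ∑ l, ginv G b x k l * K x (linChrAt G γ x (b k) (b l)) (X x))
      - ∑ k, ∑ l, ginv G b x k l * K x (b l) (linChrAt G γ x (b k) (X x)) := by
    simp only [mul_sub, Finset.sum_sub_distrib]
  rw [hsplit, T2, T3, pG, pK, dC]
  have hκsum : ∑ k, ∑ l, ginv G b x k l * cov₂At G κ x (b k) (b l) (X x) =
      fderiv ℝ (fun y ↦ mtrAt G y (κ y)) x (X x)
        + divAt G (fun y ↦ sharpAt G y (κ y (X y)) - mtrAt G y (κ y) • X y) x
        - pairAt G x (κ x) ((G x).comp (covDAt G X x)) + mtrAt G x (κ x) * divAt G X x := by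
    linarith [Tκ]
  rw [hκsum, T5]
  ring

end MomAdjointGamma

end MetricCoord

end Literature.Geometry.Lorentzian

end
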